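import Mathlib
import HarnessLib
import Literature.NumberTheory.Transcendental.AssociatorsBarEval
import Summits.KontsevichZagierPeriods.KontsevichZagierPeriods.Theorems.FurushoPentagonKernelModuloPeriodConjectureLeafLowWeight
import Summits.KontsevichZagierPeriods.KontsevichZagierPeriods.Theorems.FurushoPentagonKernelModuloPeriodConjectureLeafCert
import Summits.KontsevichZagierPeriods.KontsevichZagierPeriods.Theorems.FurushoPentagonKernelModuloPeriodConjectureLeafTableLow
import Summits.KontsevichZagierPeriods.KontsevichZagierPeriods.Theorems.FurushoPentagonKernelModuloPeriodConjectureLeafWeightFiveA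

/-!
# `KernelModuloPeriodConjecture`, line `Sketch`: the algebraic leaf in weight 7

Crux `FurushoPentagon.KernelModuloPeriodConjecture` (stmt-KontsevichZagierPeriods-15058), line
`Sketch`, registered stub `stub_associatorHoffmanSpanning` (the algebraic leaf
`AssociatorHoffmanSpanning`: Hoffman words span `𝒪(GroupLike ∩ Pent)` weight by weight). This file
proves the **weight-7 slice** unconditionally: for every admissible index `s` of weight 7 an
explicit rational certificate `c_{binaryWord s}(φ) = Σ_t b_t c_{binaryWord t}(φ)` (`t` Hoffman of
the same weight), valid at every group-like solution `φ` of Drinfeld's pentagon equation over every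
commutative `ℚ`-algebra — relation lemmas, part A (effective shuffle / regularised-stuffle rows with the lower-weight tables substituted; the leaf is in `LeafWeightSeven`).

Method. For such `φ`: (i) `c_{x₁}(φ) = 0`, `c_{x₁ⁿ}(φ) = 0` (pentagon:
`DrinfeldPentagon.apply_letter_eq_zero_of_isGroupLike`, `IsGroupLike.apply_replicate_eq_zero`);
(ii) shuffle products `c_u c_v = Σ_{w ∈ u ш v} c_w` (group-likeness), used for `u = x₁`
(regularisation of the words `x₁w`) and for pairs of convergent words (finite double shuffle);
(iii) the regularised stuffle identities `π_Y(φ)(s) π_Y(φ)(t) = Σ_{u ∈ s ∗ t} π_Y(φ)(u)` for `s`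
admissible and `t = (1,…,1)` or `t` admissible — Furusho's double shuffle for pentagon solutions in
the coefficientwise form `DrinfeldPentagon.piY_mul_piY_eq_sum_stuffle` (tree theorem; Furusho 2011,
§5). Products of lower-weight coefficients are rewritten through the lower-weight tables; the
resulting linear system in the coefficients `c_w`, `w ∈ {x₀,x₁}^{k-1}x₁`, and in the products of
Hoffman coefficients has corank `d_k` (Zagier's dimension) with the Hoffman words free — the
Ihara–Kaneko–Zagier verification of their Conjecture 1 in this weight, here for abstract pentagon
solutions. Certificates were found by exact linear algebra over `ℚ` (lead's generator
`work/gen/genlean.py`, folder of prover-line-stmt-KontsevichZagierPeriods-15058-c1) and are checked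
by `linear_combination`; denominators are cleared (`D · c_w = Σ n_t c_t`).

References: K. Ihara, M. Kaneko, D. Zagier, *Derivation and double shuffle relations for multiple
zeta values*, Compos. Math. 142 (2006), §1–§2 [IharaKanekoZagier2006]; H. Furusho, *Double shuffle
relation for associators*, Ann. of Math. 174 (2011), Thm 1.2, §5 [Furusho2011]; F. Brown, *Mixed
Tate motives over ℤ*, Ann. of Math. 175 (2012), Thm 1.1 [Brown2012].
-/

namespace Summit.KontsevichZagierPeriods.FurushoPentagon.KernelModuloPeriodConjecture

open Literature.NumberTheory.Transcendental

-- one generated `simp only` set evaluates every shuffle/stuffle hypothesis; not every lemma fires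
-- in every relation (lint debt accepted for generated certificates).
set_option linter.unusedSimpArgs false

/-- Weight-`7` relation 0 at a group-like pentagon solution: `x₁`-shuffle regularisation `0 = Σ_{w ∈
x₁ ш v} c_w` for `v = [0, 0, 0, 0, 0, 1]`. [cite: Furusho2011, §5] -/
theorem leafRel7_0 {R : Type} [CommRing R] [Algebra ℚ R] {φ : NCSeries Bool R}
    (hg : NCSeries.IsGroupLike φ) (h5 : NCSeries.DrinfeldPentagon φ) :
    (0 : R) = φ [true, false, false, false, false, false, true] + φ [false, true, false, false,
      false, false, true] + φ [false, false, true, false, false, false, true] + φ [false, false,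
      false, true, false, false, true] + φ [false, false, false, false, true, false, true] + 2 * φ
      [false, false, false, false, false, true, true] := by
  have h := hg.mul_eq_sum_shuffleWord [true] [false, false, false, false, false, true]
  simp only [MZV.shuffleWord_cons_cons, MZV.shuffleWord_nil_left, MZV.shuffleWord_nil_right,
    List.map_cons, List.map_nil, List.cons_append, List.nil_append, List.sum_cons, List.sum_nil,
    add_zero] at h
  linear_combination h - φ [false, false, false, false, false, true] * (h5.apply_letter_eq_zero_of_isGroupLike hg true)

/-- Weight-`7` relation 4 at a group-like pentagon solution: `x₁`-shuffle regularisation `0 = Σ_{w ∈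
x₁ ш v} c_w` for `v = [0, 0, 1, 0, 0, 1]`. [cite: Furusho2011, §5] -/
theorem leafRel7_4 {R : Type} [CommRing R] [Algebra ℚ R] {φ : NCSeries Bool R}
    (hg : NCSeries.IsGroupLike φ) (h5 : NCSeries.DrinfeldPentagon φ) :
    (0 : R) = φ [true, false, false, true, false, false, true] + φ [false, true, false, true, false,
      false, true] + 2 * φ [false, false, true, true, false, false, true] + φ [false, false, true,
      false, true, false, true] + 2 * φ [false, false, true, false, false, true, true] := by
  have h := hg.mul_eq_sum_shuffleWord [true] [false, false, true, false, false, true]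
  simp only [MZV.shuffleWord_cons_cons, MZV.shuffleWord_nil_left, MZV.shuffleWord_nil_right,
    List.map_cons, List.map_nil, List.cons_append, List.nil_append, List.sum_cons, List.sum_nil,
    add_zero] at h
  linear_combination h - φ [false, false, true, false, false, true] * (h5.apply_letter_eq_zero_of_isGroupLike hg true)

/-- Weight-`7` relation 5 at a group-like pentagon solution: `x₁`-shuffle regularisation `0 = Σ_{w ∈
x₁ ш v} c_w` for `v = [0, 0, 1, 0, 1, 1]`. [cite: Furusho2011, §5] -/
theorem leafRel7_5 {R : Type} [CommRing R] [Algebra ℚ R] {φ : NCSeries Bool R}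
    (hg : NCSeries.IsGroupLike φ) (h5 : NCSeries.DrinfeldPentagon φ) :
    (0 : R) = φ [true, false, false, true, false, true, true] + φ [false, true, false, true, false,
      true, true] + 2 * φ [false, false, true, true, false, true, true] + 3 * φ [false, false, true,
      false, true, true, true] := by
  have h := hg.mul_eq_sum_shuffleWord [true] [false, false, true, false, true, true]
  simp only [MZV.shuffleWord_cons_cons, MZV.shuffleWord_nil_left, MZV.shuffleWord_nil_right,
    List.map_cons, List.map_nil, List.cons_append, List.nil_append, List.sum_cons, List.sum_nil,
    add_zero] at h
  linear_combination h - φ [false, false, true, false, true, true] * (h5.apply_letter_eq_zero_of_isGroupLike hg true)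

/-- Weight-`7` relation 6 at a group-like pentagon solution: `x₁`-shuffle regularisation `0 = Σ_{w ∈
x₁ ш v} c_w` for `v = [0, 0, 1, 1, 0, 1]`. [cite: Furusho2011, §5] -/
theorem leafRel7_6 {R : Type} [CommRing R] [Algebra ℚ R] {φ : NCSeries Bool R}
    (hg : NCSeries.IsGroupLike φ) (h5 : NCSeries.DrinfeldPentagon φ) :
    (0 : R) = φ [true, false, false, true, true, false, true] + φ [false, true, false, true, true,
      false, true] + 3 * φ [false, false, true, true, true, false, true] + 2 * φ [false, false,
      true, true, false, true, true] := by
  have h := hg.mul_eq_sum_shuffleWord [true] [false, false, true, true, false, true]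
  simp only [MZV.shuffleWord_cons_cons, MZV.shuffleWord_nil_left, MZV.shuffleWord_nil_right,
    List.map_cons, List.map_nil, List.cons_append, List.nil_append, List.sum_cons, List.sum_nil,
    add_zero] at h
  linear_combination h - φ [false, false, true, true, false, true] * (h5.apply_letter_eq_zero_of_isGroupLike hg true)

/-- Weight-`7` relation 7 at a group-like pentagon solution: `x₁`-shuffle regularisation `0 = Σ_{w ∈
x₁ ш v} c_w` for `v = [0, 0, 1, 1, 1, 1]`. [cite: Furusho2011, §5] -/
theorem leafRel7_7 {R : Type} [CommRing R] [Algebra ℚ R] {φ : NCSeries Bool R}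
    (hg : NCSeries.IsGroupLike φ) (h5 : NCSeries.DrinfeldPentagon φ) :
    (0 : R) = φ [true, false, false, true, true, true, true] + φ [false, true, false, true, true,
      true, true] + 5 * φ [false, false, true, true, true, true, true] := by
  have h := hg.mul_eq_sum_shuffleWord [true] [false, false, true, true, true, true]
  simp only [MZV.shuffleWord_cons_cons, MZV.shuffleWord_nil_left, MZV.shuffleWord_nil_right,
    List.map_cons, List.map_nil, List.cons_append, List.nil_append, List.sum_cons, List.sum_nil,
    add_zero] at h
  linear_combination h - φ [false, false, true, true, true, true] * (h5.apply_letter_eq_zero_of_isGroupLike hg true)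

/-- Weight-`7` relation 8 at a group-like pentagon solution: `x₁`-shuffle regularisation `0 = Σ_{w ∈
x₁ ш v} c_w` for `v = [0, 1, 0, 0, 0, 1]`. [cite: Furusho2011, §5] -/
theorem leafRel7_8 {R : Type} [CommRing R] [Algebra ℚ R] {φ : NCSeries Bool R}
    (hg : NCSeries.IsGroupLike φ) (h5 : NCSeries.DrinfeldPentagon φ) :
    (0 : R) = φ [true, false, true, false, false, false, true] + 2 * φ [false, true, true, false,
      false, false, true] + φ [false, true, false, true, false, false, true] + φ [false, true,
      false, false, true, false, true] + 2 * φ [false, true, false, false, false, true, true] := by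
  have h := hg.mul_eq_sum_shuffleWord [true] [false, true, false, false, false, true]
  simp only [MZV.shuffleWord_cons_cons, MZV.shuffleWord_nil_left, MZV.shuffleWord_nil_right,
    List.map_cons, List.map_nil, List.cons_append, List.nil_append, List.sum_cons, List.sum_nil,
    add_zero] at h
  linear_combination h - φ [false, true, false, false, false, true] * (h5.apply_letter_eq_zero_of_isGroupLike hg true)

/-- Weight-`7` relation 10 at a group-like pentagon solution: `x₁`-shuffle regularisation `0 = Σ_{w
∈ x₁ ш v} c_w` for `v = [0, 1, 0, 1, 0, 1]`. [cite: Furusho2011, §5] -/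
theorem leafRel7_10 {R : Type} [CommRing R] [Algebra ℚ R] {φ : NCSeries Bool R}
    (hg : NCSeries.IsGroupLike φ) (h5 : NCSeries.DrinfeldPentagon φ) :
    (0 : R) = φ [true, false, true, false, true, false, true] + 2 * φ [false, true, true, false,
      true, false, true] + 2 * φ [false, true, false, true, true, false, true] + 2 * φ [false, true,
      false, true, false, true, true] := by
  have h := hg.mul_eq_sum_shuffleWord [true] [false, true, false, true, false, true]
  simp only [MZV.shuffleWord_cons_cons, MZV.shuffleWord_nil_left, MZV.shuffleWord_nil_right,
    List.map_cons, List.map_nil, List.cons_append, List.nil_append, List.sum_cons, List.sum_nil,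
    add_zero] at h
  linear_combination h - φ [false, true, false, true, false, true] * (h5.apply_letter_eq_zero_of_isGroupLike hg true)

/-- Weight-`7` relation 11 at a group-like pentagon solution: `x₁`-shuffle regularisation `0 = Σ_{w
∈ x₁ ш v} c_w` for `v = [0, 1, 0, 1, 1, 1]`. [cite: Furusho2011, §5] -/
theorem leafRel7_11 {R : Type} [CommRing R] [Algebra ℚ R] {φ : NCSeries Bool R}
    (hg : NCSeries.IsGroupLike φ) (h5 : NCSeries.DrinfeldPentagon φ) :
    (0 : R) = φ [true, false, true, false, true, true, true] + 2 * φ [false, true, true, false,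
      true, true, true] + 4 * φ [false, true, false, true, true, true, true] := by
  have h := hg.mul_eq_sum_shuffleWord [true] [false, true, false, true, true, true]
  simp only [MZV.shuffleWord_cons_cons, MZV.shuffleWord_nil_left, MZV.shuffleWord_nil_right,
    List.map_cons, List.map_nil, List.cons_append, List.nil_append, List.sum_cons, List.sum_nil,
    add_zero] at h
  linear_combination h - φ [false, true, false, true, true, true] * (h5.apply_letter_eq_zero_of_isGroupLike hg true)

/-- Weight-`7` relation 12 at a group-like pentagon solution: `x₁`-shuffle regularisation `0 = Σ_{w
∈ x₁ ш v} c_w` for `v = [0, 1, 1, 0, 0, 1]`. [cite: Furusho2011, §5] -/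
theorem leafRel7_12 {R : Type} [CommRing R] [Algebra ℚ R] {φ : NCSeries Bool R}
    (hg : NCSeries.IsGroupLike φ) (h5 : NCSeries.DrinfeldPentagon φ) :
    (0 : R) = φ [true, false, true, true, false, false, true] + 3 * φ [false, true, true, true,
      false, false, true] + φ [false, true, true, false, true, false, true] + 2 * φ [false, true,
      true, false, false, true, true] := by
  have h := hg.mul_eq_sum_shuffleWord [true] [false, true, true, false, false, true]
  simp only [MZV.shuffleWord_cons_cons, MZV.shuffleWord_nil_left, MZV.shuffleWord_nil_right,
    List.map_cons, List.map_nil, List.cons_append, List.nil_append, List.sum_cons, List.sum_nil,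
    add_zero] at h
  linear_combination h - φ [false, true, true, false, false, true] * (h5.apply_letter_eq_zero_of_isGroupLike hg true)

/-- Weight-`7` relation 13 at a group-like pentagon solution: `x₁`-shuffle regularisation `0 = Σ_{w
∈ x₁ ш v} c_w` for `v = [0, 1, 1, 0, 1, 1]`. [cite: Furusho2011, §5] -/
theorem leafRel7_13 {R : Type} [CommRing R] [Algebra ℚ R] {φ : NCSeries Bool R}
    (hg : NCSeries.IsGroupLike φ) (h5 : NCSeries.DrinfeldPentagon φ) :
    (0 : R) = φ [true, false, true, true, false, true, true] + 3 * φ [false, true, true, true,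
      false, true, true] + 3 * φ [false, true, true, false, true, true, true] := by
  have h := hg.mul_eq_sum_shuffleWord [true] [false, true, true, false, true, true]
  simp only [MZV.shuffleWord_cons_cons, MZV.shuffleWord_nil_left, MZV.shuffleWord_nil_right,
    List.map_cons, List.map_nil, List.cons_append, List.nil_append, List.sum_cons, List.sum_nil,
    add_zero] at h
  linear_combination h - φ [false, true, true, false, true, true] * (h5.apply_letter_eq_zero_of_isGroupLike hg true)

/-- Weight-`7` relation 14 at a group-like pentagon solution: `x₁`-shuffle regularisation `0 = Σ_{w
∈ x₁ ш v} c_w` for `v = [0, 1, 1, 1, 0, 1]`. [cite: Furusho2011, §5] -/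
theorem leafRel7_14 {R : Type} [CommRing R] [Algebra ℚ R] {φ : NCSeries Bool R}
    (hg : NCSeries.IsGroupLike φ) (h5 : NCSeries.DrinfeldPentagon φ) :
    (0 : R) = φ [true, false, true, true, true, false, true] + 4 * φ [false, true, true, true, true,
      false, true] + 2 * φ [false, true, true, true, false, true, true] := by
  have h := hg.mul_eq_sum_shuffleWord [true] [false, true, true, true, false, true]
  simp only [MZV.shuffleWord_cons_cons, MZV.shuffleWord_nil_left, MZV.shuffleWord_nil_right,
    List.map_cons, List.map_nil, List.cons_append, List.nil_append, List.sum_cons, List.sum_nil,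
    add_zero] at h
  linear_combination h - φ [false, true, true, true, false, true] * (h5.apply_letter_eq_zero_of_isGroupLike hg true)

/-- Weight-`7` relation 15 at a group-like pentagon solution: `x₁`-shuffle regularisation `0 = Σ_{w
∈ x₁ ш v} c_w` for `v = [0, 1, 1, 1, 1, 1]`. [cite: Furusho2011, §5] -/
theorem leafRel7_15 {R : Type} [CommRing R] [Algebra ℚ R] {φ : NCSeries Bool R}
    (hg : NCSeries.IsGroupLike φ) (h5 : NCSeries.DrinfeldPentagon φ) :
    (0 : R) = φ [true, false, true, true, true, true, true] + 6 * φ [false, true, true, true, true,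
      true, true] := by
  have h := hg.mul_eq_sum_shuffleWord [true] [false, true, true, true, true, true]
  simp only [MZV.shuffleWord_cons_cons, MZV.shuffleWord_nil_left, MZV.shuffleWord_nil_right,
    List.map_cons, List.map_nil, List.cons_append, List.nil_append, List.sum_cons, List.sum_nil,
    add_zero] at h
  linear_combination h - φ [false, true, true, true, true, true] * (h5.apply_letter_eq_zero_of_isGroupLike hg true)

/-- Weight-`7` relation 18 at a group-like pentagon solution: `x₁`-shuffle regularisation `0 = Σ_{w
∈ x₁ ш v} c_w` for `v = [1, 0, 0, 1, 0, 1]`. [cite: Furusho2011, §5] -/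
theorem leafRel7_18 {R : Type} [CommRing R] [Algebra ℚ R] {φ : NCSeries Bool R}
    (hg : NCSeries.IsGroupLike φ) (h5 : NCSeries.DrinfeldPentagon φ) :
    (0 : R) = 2 * φ [true, true, false, false, true, false, true] + φ [true, false, true, false,
      true, false, true] + 2 * φ [true, false, false, true, true, false, true] + 2 * φ [true, false,
      false, true, false, true, true] := by
  have h := hg.mul_eq_sum_shuffleWord [true] [true, false, false, true, false, true]
  simp only [MZV.shuffleWord_cons_cons, MZV.shuffleWord_nil_left, MZV.shuffleWord_nil_right,
    List.map_cons, List.map_nil, List.cons_append, List.nil_append, List.sum_cons, List.sum_nil,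
    add_zero] at h
  linear_combination h - φ [true, false, false, true, false, true] * (h5.apply_letter_eq_zero_of_isGroupLike hg true)

/-- Weight-`7` relation 19 at a group-like pentagon solution: `x₁`-shuffle regularisation `0 = Σ_{w
∈ x₁ ш v} c_w` for `v = [1, 0, 0, 1, 1, 1]`. [cite: Furusho2011, §5] -/
theorem leafRel7_19 {R : Type} [CommRing R] [Algebra ℚ R] {φ : NCSeries Bool R}
    (hg : NCSeries.IsGroupLike φ) (h5 : NCSeries.DrinfeldPentagon φ) :
    (0 : R) = 2 * φ [true, true, false, false, true, true, true] + φ [true, false, true, false,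
      true, true, true] + 4 * φ [true, false, false, true, true, true, true] := by
  have h := hg.mul_eq_sum_shuffleWord [true] [true, false, false, true, true, true]
  simp only [MZV.shuffleWord_cons_cons, MZV.shuffleWord_nil_left, MZV.shuffleWord_nil_right,
    List.map_cons, List.map_nil, List.cons_append, List.nil_append, List.sum_cons, List.sum_nil,
    add_zero] at h
  linear_combination h - φ [true, false, false, true, true, true] * (h5.apply_letter_eq_zero_of_isGroupLike hg true)

/-- **Registered sub-goal `stub_leafRel7A`** (crux stmt-KontsevichZagierPeriods-15058, line `Sketch`): the
first relation of this part in `∀`-form (`leafRel7_0`). [cite: Furusho2011, §5] -/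
theorem stub_leafRel7A : ∀ (R : Type) [CommRing R] [Algebra ℚ R] (φ : NCSeries Bool R), NCSeries.IsGroupLike φ → NCSeries.DrinfeldPentagon φ → (0 : R) = φ [true, false, false, false, false, false, true] + φ [false, true, false, false, false, false, true] + φ [false, false, true, false, false, false, true] + φ [false, false, false, true, false, false, true] + φ [false, false, false, false, true, false, true] + 2 * φ [false, false, false, false, false, true, true] :=
  fun _ _ _ _ hg h5 => leafRel7_0 hg h5

end Summit.KontsevichZagierPeriods.FurushoPentagon.KernelModuloPeriodConjecture
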